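import Mathlib
import HarnessLib
import HarnessLib.Audit
import Summits.CriticalPhenomena.Statement
import Literature.Probability.Percolation.CardyFormula
import Literature.Probability.LatticeModels.CornerFugacityStrip
import Literature.Probability.LatticeModels.CornerFugacityMeasure
import HarnessLib.Audit.Status.Attr

/-!
Route: CardyCornerFugacity

DORMANT since 2026-08-22T10:18:10Z (reconciler: no traction for 5.3 d (last activity item-evidence-added at 2026-08-17T03:10:56Z); parked, not closed — `ledger route dormant route-CriticalPhenomena-CardyCornerFugacity --off` to reactiva) — unstaffed, not closed; items shared with open routes are served there. `ledger route dormant <id> --off` reactivates.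

# Route CardyCornerFugacity — corner-fugacity descent to DIAGONAL bond-Z2 half-strips - wall events
teleport exactly from site-T through the isotropic IK point, and subsequential conformal transport
(not X_U) closes

It suffices to show X = TallDiagonalRectCardy ∧ SeqConfTransport (card corner-fugacity-plane, "Route
1", made
typable and geometrically exact). TallDiagonalRectCardy: for every η ∈ (0,1) and ε > 0, all
sufficiently TALL
45°-rotated rectangles Ω_h = (1+i)·((0,1)×(0,h)) marked by two points a, b of the open base and by
the two base CORNERS
c = 1+i, d = 0, of cross-ratio η, have P_{1/2} bond-ℤ² crossing probabilities (G02
`bondDomainCrossingProb`: base arc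
[a,b] joined inside Ω_δ to the side/top arc) eventually within ε of F(η) as δ → 0⁺.
SeqConfTransport: two conformal
rectangles with uniformizing data of equal cross-ratio have the same crossing limits ALONG EVERY
COMMON SEQUENCE
δ_k → 0⁺ (conformal covariance of subsequential limits; strictly weaker than X_U = stmt-0745 and
than
LimitExists+ConfInvTransport = stmt-0747+0794, no existence of limits asked). Why these two: the
corner-fugacity
plane delivers Cardy VALUES exactly where its mechanism lands — base-to-WALL events of DIAGONAL
half-strips of ℤ²
(the t = 0 freezing point of the PLAIN-wall cell-strip model is bond-ℤ² on the 45°-rotated renewal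
sub-lattice; the
integrable anchor is Morin-Duchesne–Klümper–Pearce's fixed-colour strip — rows of alternating width,
every full face
weighted, wall faces included (route-repair 2026-08-15: the constant-width, cost-free-wall wording
was refuted from
L = 3 and is replaced by IKWallLawTeleportR, typed) — and base-to-wall events are then carried to
the plain wall by
one boundary-irrelevance statement at the isotropic point, IsotropicWallSeam) — and pinning the
value along subsequences makes uniqueness of the limit unnecessary. The assembly
X → BaseMarkedRealises → CardyFormulaZ2 is PROVED sorry-free in the planner sketch (subsequence
extraction).
Lean: `TallDiagonalRectCardy ∧ SeqConfTransport` — i.e. `(∀ η ∈ Set.Ioo (0:ℝ) 1, ∀ ε : ℝ, 0 < ε → ∃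
h₀ : ℝ, ∀ h : ℝ, h₀ ≤ h → ∀ (R : Literature.Probability.RandomPlanarGeometry.ConformalRectangle),
R.carrier = (fun z : ℂ ↦ (1 + Complex.I) * z) '' (Set.Ioo (0:ℝ) 1 ×ℂ Set.Ioo (0:ℝ) h) → R.pt 0 ∈
openSegment ℝ (0:ℂ) (1 + Complex.I) → R.pt 1 ∈ openSegment ℝ (0:ℂ) (1 + Complex.I) → R.pt 2 = 1 +
Complex.I → R.pt 3 = 0 → ∀ (φ : Literature.Probability.RandomPlanarGeometry.ConformalEquiv
UpperHalfPlane.upperHalfPlaneSet R.carrier) (x : Fin 4 → ℝ), R.IsUniformizing φ x →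
Literature.Probability.RandomPlanarGeometry.crossRatio x = η → ∀ᶠ δ in nhdsWithin (0:ℝ) (Set.Ioi 0),
|Literature.Probability.Percolation.bondDomainCrossingProb R δ -
Literature.Probability.RandomPlanarGeometry.cardyFunction η| ≤ ε) ∧ (∀ (R R' :
Literature.Probability.RandomPlanarGeometry.ConformalRectangle) (φ :
Literature.Probability.RandomPlanarGeometry.ConformalEquiv UpperHalfPlane.upperHalfPlaneSet
R.carrier) (x : Fin 4 → ℝ) (φ' : Literature.Probability.RandomPlanarGeometry.ConformalEquiv
UpperHalfPlane.upperHalfPlaneSet R'.carrier) (x' : Fin 4 → ℝ), R.IsUniformizing φ x →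
R'.IsUniformizing φ' x' → Literature.Probability.RandomPlanarGeometry.crossRatio x =
Literature.Probability.RandomPlanarGeometry.crossRatio x' → ∀ (s : ℕ → ℝ), Filter.Tendsto s
Filter.atTop (nhdsWithin 0 (Set.Ioi 0)) → ∀ L : ℝ, Filter.Tendsto (fun k ↦
Literature.Probability.Percolation.bondDomainCrossingProb R (s k)) Filter.atTop (nhds L) →
Filter.Tendsto (fun k ↦ Literature.Probability.Percolation.bondDomainCrossingProb R' (s k))
Filter.atTop (nhds L))`

## Assembly
Elementary real analysis, PROVED sorry-free in the planner sketch (`assembly_proof`, axioms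
propext/Classical.choice/
Quot.sound): given R' with datum (φ', x'), η = crossRatio x' ∈ (0,1)
(crossRatio_mem_Ioo_of_isUniformizing); if
P(R', δ) did not converge to F(η), extract (exists_seq_forall_of_frequently) a sequence δ_k → 0⁺
with
|P(R', δ_k) − F(η)| ≥ ε and, for a tall base-marked R of cross-ratio η (BaseMarkedRealises, h ≥
h₀(η, ε/3)),
|P(R, δ_k) − F(η)| ≤ ε/3 (TallDiagonalRectCardy); a further subsequence has P(R, δ_k) → L
(Bolzano–Weierstrass in
[0,1]), SeqConfTransport carries L to R', and ε ≤ |L − F(η)| ≤ ε/3 is absurd.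

Rationale: WHY THIS LINE. The corner-fugacity plane (card corner-fugacity-plane; refuter audit 2026-08-15) puts
bond-ℤ², site-𝕋 and the n = 1
Izergin–Korepin (dilute A₂⁽²⁾, λ = π/3, q³ = −1) integrable line into ONE exactly self-dual,
colour-symmetric family
M(t,b) on ℤ²'s cell grid: corner fugacity t, saddle bias b; the IK line is t = √3/(2 sin u), b =
sin(2π/3−u)/sin u,
u ∈ [π/3, 2π/3] (GarbaliNienhuis2017 = arXiv:1411.7020 §2–3; MorinduchesneKlumperPearce2023 =
arXiv:2211.12379
§2.2/§3.1/§3.6: u = π/3 IS site percolation on 𝕋 by the Fehér–Nienhuis map, u = π/2 the D₄-symmetric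
point
(1, 1, √3/2; ½, ½); in the tree: ikCornerFugacity, ikCoinBias, cornerGibbsMeasure,
cornerFugacityStrip). On the PLAIN
strip (cornerFugacityStrip t ½ L: solid black walls, wall faces unweighted) the colouring marginal
is the exactly
solvable 4-spin plaquette field (independent column flip-chains, flip probability t/(1+t)) and t = 0
freezes to XOR
colourings = bond percolation at ½ on the 45°-ROTATED renewal sub-lattice. Imported area:
Yang–Baxter integrability
with boundaries — MDKP §3.6 shows the transfer matrix of the fixed-colour percolation strip IS
½·D̂(π/3), a member of
the commuting family of double-row transfer tangles D̂(u) with κ⁺ boundary triangles (κ⁺₁ = κ⁺₂ =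
cos u for every u
because 3λ/2 = π/2; [D̂(u), D̂(v)] = 0, §3.5, YungBatchelor1995), so Perron–Frobenius teleports the
base law of the
half-infinite MDKP strip from u = π/3, where Smirnov's theorem is PROVED in the tree
(hasCrossingLimit_triDomainCrossingProb_holds), to u = π/2 exactly, at every width. ROUTE-REPAIR
2026-08-15: the
strip on which this is an identity is MDKP's — rows of ALTERNATING width L / L+1 with the outermost
cell of each row
fixed black, and EVERY full face weighted, the faces containing wall cells included; the original
wording
(constant width, cost-free wall faces) is false from L = 3 (refuter crux-attack, exact: 13/28 vs
(90−3√3)/184) and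
is replaced by IKWallLawTeleportR, now TYPED over cornerGibbsMeasure / baseState; the repair opens
one seam —
the weighted integrable wall cannot be kept down to t = 0 (it freezes the strip into vertical
stripes), so the
descent in t runs on the plain wall and a boundary-irrelevance statement at the isotropic point
(IsotropicWallSeam) joins the two. What this route does that the sibling routes do not
(CardyPerronTeleport:
AXIS-PARALLEL free-wall ℤ² half-strips, four base marks and X_U; CardyIKTransport: the all-quads
descent
CornerLineDescent behind a GM-type IK transport): (i) it types the target the mechanism actually
reaches —
DIAGONAL half-strips and base-to-WALL events (marks a, b, corner, corner), for which the
fixed-colour integrable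
boundary is the natural one and the 𝕋-side limit is a SINGLE Cardy value; (ii) it replaces X_U by
conformal
transport along subsequences (assembly proved); (iii) it isolates the open content of the line in
two universality
statements on one event family inside one lattice's cell models (CornerIrrelevanceWall:
t-independence on the plain
strip; IsotropicWallSeam: wall-weight independence at t = √3/2) plus the DKKMO-programme output
(SeqConfTransport).
Negatives index (7 entries, SAW / Z3 / CardyUniqueLimit / CardyDualCurrent): unrelated.

RANKED CRUXES. r2 IKWallLawTeleportR (crux, TYPED; the integrability identity the line imports,
hence FIRST): on the half-infinite MDKP
strip S_L (herringbone cell rows; even rows free cells 0..L−1, odd rows 0..L; column −1, the even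
cells of column L
and column L+1 black; truncated at height N → ∞) the law of baseState (L+1) (connection matrix of
left-wall foot,
base cells, right-wall cells inside the closed strip) has the SAME N → ∞ limit under (a)
cornerGibbsMeasure
(ikCornerFugacity (π/2)) with face set {−1..L−1}×{0..N−1} (all full faces, wall faces included) ⊗
fair coins and
(b) the uniform colouring ⊗ herringbone coins (= critical site percolation on the triangular strip
with fixed-black
boundary columns). Verified exactly at L = 3,4,5 by the refuter (11/24, 409/928, 97849/226688,
4265/10304) and to
1e-14 at widths ≤ 8 on the double-comb form. Why it might fail: Perron primitivity + stochastic
normalisation of D̂(u)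
on the wall-marked link module and the u = π/2 identity double-comb ≡ S_L are unprinted (checked L ≤
5 only).
Sources: arXiv:2211.12379 §2.1–2.2, §3.5–3.6; arXiv:1411.7020 §3; YungBatchelor1995; evidence
CRUX-ATTACK-7739.md,
TELEPORT-CHECK.md (kit j004602, j001310).
r3 CornerIrrelevanceWall (crux, TYPED over cornerFugacityStrip): ∀ 0 < a < b < 1 ∃ Φ ∀ t ∈ [0,
√3/2],
P_{t,½,L}(wallEvent L [aL,bL]) → Φ as L → ∞ on the PLAIN strip. Why it might fail: one-lattice
universality with no
FKG/RSW for 0 < t < √3/2; t → 0⁺ singular (correlation length ≈ 1/(2t)). Sources: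
Beffara2008Universal §5;
GarbanPeteSchramm2010 §2; BloteNienhuis1989;
Literature.Barriers.CriticalPhenomena.CoveringLatticeShift.
#4 TallDiagonalRectCardy, #5 SeqConfTransport (typed frame, unchanged; consequences of the
conjunct).
r6 IsotropicWallSeam (crux, TYPED, new): at (√3/2, ½) the L → ∞ limit of P(wallEvent L [aL,bL]) is
the same for the
weighted MDKP wall of r2 and for the plain wall of cornerFugacityStrip (if the plain-strip limit is
Φ, the MDKP-strip
limits q_L → Φ). Why it might fail: boundary-condition irrelevance for a dependent non-FKG model; a
corner cost along
the wall could pin/repel hulls and shift base-to-wall limits; numerics at L ≤ 8 cannot exclude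
O(L^−ε) drifts.
Sources: Cardy1992 (one boundary universality class at Q → 1); arXiv:2211.12379 §3.1;
BloteNienhuis1989.
Supports: #9 BaseMarkedRealises (typed, provable now); #9 TriStripWallCardy (TYPED, replaces
HerringboneWallCardyT:
Smirnov on S_L ⇒ q_L → F(crossRatio(−cos πa, −cos πb, 1, −1)), half-strip uniformised by w = −cos
πz);
#9 FreezeToWiredDiagonal (informal, plain strip at t = 0; unchanged).

TWO-LAYER PLAN. TallDiagonalRectCardy ⇐ [TriStripWallCardy + IKWallLawTeleportR ⇒ q_L → F(η(a,b)) on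
the MDKP strip at u = π/2]
+ [IsotropicWallSeam + CornerIrrelevanceWall ⇒ the plain-strip limit Φ(a,b) exists for all t ∈ [0,
√3/2] and equals
F(η(a,b))] + [FreezeToWiredDiagonal: at t = 0 the plain strip is bond-ℤ² on the rotated renewal
lattice with wired
diagonal walls; Bin(L,½) renewal counts, equicontinuity in the marks (rsw_half_holds), e^(−ch)
truncation and the
tall-rectangle/half-strip cross-ratio comparison give the δ-limits]. A formal split of
TallDiagonalRectCardy into
these (k = 3: TeleportedWallCardy, PlainWallCardy, DiagonalFreeze) is for tenure once r2 is
re-vetted. Lemmas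
provers will need under r2: wallEvent L I is a function of baseState (L+1) on the S_L encoding (the
fake black cells
(L+1, even) create no adjacency to free cells; a black odd cell of column L is edge-joined to the
wall).

KILL CRITERIA. Refutation of TallDiagonalRectCardy or SeqConfTransport refutes CardyFormulaZ2 itself
— report to operator, close every
Cardy route. ¬IKWallLawTeleportR at ANY single L (an exact transfer-matrix discrepancy between the
two sides of the
typed statement) kills r2 as typed: if the discrepancy is again a boundary-convention slip with an
exact variant
(double-comb strip) the planner restates once more; if no fixed-colour strip teleports, close the
line
`refuted:IKWallLawTeleportR` (the cylinder teleport belongs to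
CardyPerronTeleport/CardyIKTransport). ¬IsotropicWallSeam
(wall-weight dependence of base-to-wall limits at the isotropic point) or ¬CornerIrrelevanceWall
(two different
limits along t) each refute universality inside one lattice's cell models — first-rank negative
results; close
`refuted:<item>`. If CardyPerronTeleport's HalfStripUniversality or CardyIKTransport's
CornerLineDescent closes
first, this route is superseded up to the diagonal/wall restatement; if X_U (0745) closes,
SeqConfTransport is moot.

NOT DECOMPOSED YET. Everything under TallDiagonalRectCardy beyond the items above (renewal LLN,
discretisation bookkeeping against G02's
largest-component Ω_δ for rotated rectangles, corner uniformity of the tall-rectangle cross-ratio,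
e^(−ch)
truncation); the proof structure of r2 (CommutingStochasticFamily for D̂(u) → PerronUnique →
EndpointDictionary at
u = π/3 (MDKP §3.6, printed) and u = π/2 (double-comb ≡ S_L, unprinted)); RSW for M(t,½) at
intermediate t; the
four-base-mark / free-wall variant of the anchor (GN's ζ-family); the b ≠ ½ affine family.
SeqConfTransport is
imported whole from the DKKMO programme (CardyViaSLE6 r2 / CardyRotToConf), never split here.

CHEAPEST FALSIFIER. (1) r2 is an identity at EVERY L: rerun the refuter's exact transfer-matrix code
(teleport7739.py, geometry H1 =
exactly the typed encoding: even rows free 0..L−1, odd rows free 0..L, faces x = −1..L−1 weighted on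
the M side,
herringbone coins on the T side, free base and top) at L = 6, 7 (kit, minutes to hours); one wrong
digit kills r2.
(2) r6: same code, compare P(wallEvent) under the plain strip V0 (cornerFugacityStrip √3/2 ½ L) and
under H1 at
u = π/2 for L = 3..10 and fit the gap against L: a gap that does not shrink kills the seam cheaply
(a shrinking one
proves nothing). (3) r3: exact t = 0 wall-event limits (renewal combinatorics, closed form) vs
transfer-matrix values
at t = √3/2 extrapolated in L.

NUMBERS. IK line: (vacancy, straight, turn; b, 1−b) = (1, 1, √3/(2 sin u); sin(2π/3−u)/sin u,
sin(u−π/3)/sin u),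
u ∈ [π/3, 2π/3]; isotropic point (√3/2 ≈ 0.866; ½). Boundary triangles: κ⁺₁(u) = sin(3λ/2 − u) =
κ⁺₂(u) = cos u at
λ = π/3 (MDKP §3.1, §3.6: 'choice 1 with equal Boltzmann weights … proportional to the identity
strand');
D_perc = ½ D̂(π/3). Refuter's exact base-law data (CRUX-ATTACK-7739.md): as-worded V0, L = 3: P(base
cell 1 black &
wall-joined) = 13/28 (𝕋) vs (90−3√3)/184 ≈ 0.46089 (M) — FALSE; repaired H1: common values 11/24
(L=3), 409/928
(L=4), 97849/226688 and 4265/10304 (L=5), Perron root c₁₂/2¹² = 3650401/4096 at L = 5; double comb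
u-independent to
4e-36 at u ∈ {π/3, 5π/12, π/2, 2π/3}; TV ≤ 1.3e-14 at W = 5..8 (TELEPORT-CHECK.md). Plaquette field
on the plain
strip: ⟨τ(y)τ(y+r)⟩ = ((1−t)/(1+t))^r, correlation length ≈ 1/(2t). Half-strip uniformisation w =
−cos(πz):
η(a,b) = crossRatio(−cos πa, −cos πb, 1, −1), e.g. η(1/3, 1/2) = 2/3 (checked by norm_num). Items
after repair:
8 typed (5 cruxes r2 r3 #4 #5 r6, 2 supports, assembly) + 1 informal support
(FreezeToWiredDiagonal).

DEFINITION REQUESTS. None open. D1 cornerFugacityStrip t b L / D1′ herringboneTriStrip L LANDED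
(Literature/Probability/LatticeModels/CornerFugacityStrip.lean: wallEvent, baseState, stripMark,
herringboneCoin);
the MDKP strip of r2/r6/TriStripWallCardy is written inline over cornerGibbsMeasure t V Λ ξ,
coinMeasure,
ikCornerFugacity, ikCoinBias (CornerFugacityMeasure.lean) — no new notion needed. Note for definers:
the docstring of
herringboneTriStrip calls the constant-width strip MDKP's §2.1–2.2 strip; MDKP's strip has
alternating widths (this
matters exactly here), a doc fix worth a maintenance proposal.

Novelty: Searches (2026-08-15): `lit galaxy search --star all` ×6 ("O(n) model on the square lattice": 4
rows, Jacobsen's CFT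
chapter + 2 JLS papers, none on n=1 boundary teleport; "corner fugacity", "dilute O(1)", "plaquette
model percolation
hulls", "dilute loop model site percolation": 0 rows or queue-saturated); `lit search --hybrid`
(local: only textbooks:
BollobasRiordan2006, Grimmett RCM); `lit search --source zbmath` ×6 (hits: arXiv:2211.12379 MDKP
2023 — the anchor
identification in print; arXiv:1507.03027 Jacobsen 2015; YungBatchelor1995; GN
arXiv:1411.7020/1411.7160); `lit
frontier CriticalPhenomena --since 2020` (30 rows; relevant: arXiv:2603.28161 boundary four-point
connectivities of
CLE — the wired-wall four-mark law that this route AVOIDS needing); `lit bridges CriticalPhenomena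
--cross any`
(nothing on interpolation families); `lit read arxiv:1411.7020` pp. 3–6 and `arxiv:2211.12379` pp.
6–8 (weights,
K-matrices, herringbone map, fixed-colour walls) — quoted above; the six sibling Theses files +
today's
CardyPerronTeleport / CardyIKTransport / CardySelfDualSegment read in full.
Nearest prior art found: MorinduchesneKlumperPearce2023 (arXiv:2211.12379: site-𝕋 percolation as the
λ = π/3 dilute
A₂⁽²⁾ model, commuting transfer tangles, conformal spectra — no transport of Cardy VALUES to another
point of the
commuting line, no bond-ℤ²); GarbaliNienhuis2017 (arXiv:1411.7020: the q³ = −1 open-boundary ground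
state via qKZ);
Beffara2008Universal §5 (arXiv:0708.3908, the only  [refs: 2211.12379, 1507.03027, 1411.7020, 2603.28161, 0708.3908, arxiv:1411.7020, arxiv:2211.12379, BollobasRiordan2006, YungBatchelor1995, MorinduchesneKlumperPearce2023, GarbaliNienhuis2017]

Barriers (technique_class: model-interpolation, integrable-anchor, transfer-matrix): - technique_class: model-interpolation, integrable-anchor, transfer-matrix
- Literature.Barriers.CriticalPhenomena.CoveringLatticeShift: its mechanism (the one-step shift maps
P_{½,q} to P_{½,1−q}, so v and v′ are pivotal under different laws) does not arise — every M(t,½) is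
translation invariant, exactly self-dual and colour-symmetric on ONE lattice and no Russo pairing is
used at open; its generic residue (one-lattice universality) is conceded and isolated as
CornerIrrelevanceWall: it does not evade that; the bet is that exact endpoints (Perron identity at t
= √3/2, XOR freezing at t = 0) and exact self-duality/D₄ at every t make this the cleanest instance.
- Literature.Barriers.CriticalPhenomena.CoveringLatticeShiftNarrow: outside its scope — it blocks
EXACT identities that use a type-exchanging lattice symmetry alone or the colour flip alone under
Beffara's inhomogeneous product law P_{½,q}, q ≠ ½, on the covering lattice; every M(t,b) is a
homogeneous (one site type) model for which the global colour flip and all of D₄ ⋉ ℤ² are EXACT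
symmetries at every (t,b), no Russo pairing Δ(v) is filed, and the only exact identity used
(IKWallLawTeleport) is a commuting-transfer-matrix / Perron identity, not a symmetry pairing; the
residual universality content is conceded as CornerIrrelevanceWall (see CoveringLatticeShift line).
- Literature.Barriers.CriticalPhenomena.GridSAWCountingSharpPComplete: does not apply — the token
transfer-matrix here means the width-L strip transfer ta

History (route lifecycle, newest last):
- 2026-08-15T21:34:52Z · rev 4: restated IKWallLawTeleport (stmt-CriticalPhenomena-7739), HerringboneWallCardyT (stmt-CriticalPhenomena-7756) — repair (route-repair bd59e126): IKWallLawTeleport (stmt-7739) refuted-MISSTATED as worded by refuter crux-attack CRUX-ATTACK-7739.md (constant-width strip, cost (planner-rrefute-CriticalPhenomena-CardyCornerF-bd59e126-0)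
- 2026-08-22T10:18:10Z · DORMANT — reconciler: no traction for 5.3 d (last activity item-evidence-added at 2026-08-17T03:10:56Z); parked, not closed — `ledger route dormant route-CriticalPhenomen (operator:999:2955986)

sub-problem: CardyFormulaZ2 · status: dormant · opened planner-plancard-CriticalPhenomena-CardyFormu-7d589fbe-0 2026-08-15T12:08:03Z · rev 5 · ledger route-CriticalPhenomena-CardyCornerFugacity
GENERATED by the gate from the ledger (D-0016/17). Provers cite these decls: `theorem foo : Summit.CriticalPhenomena.CardyFormulaZ2.Theses.CardyCornerFugacity.<Decl> := …` in Summits/CriticalPhenomena/CardyFormulaZ2/Theorems/<Name>.lean.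
-/

namespace Summit.CriticalPhenomena.CardyFormulaZ2.Theses.CardyCornerFugacity

open scoped BigOperators Topology Manifold Classical MeasureTheory ProbabilityTheory Matrix InnerProductSpace ComplexConjugate ContinuousMap
open Filter Set Function TopologicalSpace MeasureTheory

attribute [summit_statement] _root_.CardyFormulaZ2

/-- item stmt-CriticalPhenomena-13902 · crux · rank 2 · open · by planner
why it might fail: Rests on Perron primitivity + a stochastic normalisation of MDKP's D̂(u) on the wall-marked dilute link module and on the u=π/2 identity double-comb strip ≡ S_L — both unprinted, checked only exactly at L≤5 (1e-14 at W≤8); a first exact discrepancy at L=6,7 kills it.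
sources: arXiv:2211.12379, arXiv:1411.7020, YungBatchelor1995, BloteNienhuis1989, evidence:stmt-CriticalPhenomena-7739/CRUX-ATTACK-7739.md (refuter rattack-7739-0, kit j004602), evidence:stmt-CriticalPhenomena-7739/TELEPORT-CHECK.md (refuter rreview 4b03b2ae-0, kit j001310)
[crux] IKWallLawTeleportR (rank 2; REPAIRED IKWallLawTeleport — stmt-CriticalPhenomena-7739 as
worded (constant-width strip, solid walls every row, cost-free wall faces, vs the constant-width
herringbone 𝕋 strip) is FALSE from L = 3: P(base cell 1 black & wall-joined) = 13/28 vs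
(90−3√3)/184, refuter crux-attack CRUX-ATTACK-7739.md; this is the refuter's repaired C′, now
TYPED). SETTING = the half-infinite Morin-Duchesne–Klümper–Pearce strip S_L (arXiv:2211.12379
§2.1–2.2 cut open; hexagon rows alternating L+2 / L+3 cells, the outermost cell of every row fixed
BLACK), drawn on the cell grid in herringbone coordinates: rows y ≥ 0; even rows have free cells x =
0..L−1, odd rows x = 0..L; black wall cells = column −1, the even-row cells of column L, and column
L+1 (the odd-row wall cells (L+1, y) plus harmless extra cells (L+1, even y) that make the zigzag
right wall edge-connected inside closedStrip (L+1) and are adjacent to no free cell); triangular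
adjacency = NE–SW diagonals on even face rows, NW–SE on odd ones (herringboneCoin); truncated at
height N (free cells above row N white), N → ∞. Every face row then has exactly L+1 full 4-cell
faces, x = −1..L−1 (the outer ones contain w -/
@[route_item "route-CriticalPhenomena-CardyCornerFugacity"]
def IKWallLawTeleportR : Prop :=
  ∀ L : ℕ, 1 ≤ L → let Λ : ℕ → Finset (Literature.Probability.LatticeModels.Site 2) := fun N => ((Finset.range L ×ˢ Finset.range (N + 1)).image fun p : ℕ × ℕ => ![(p.1 : ℤ), (p.2 : ℤ)]) ∪ (((Finset.range (N + 1)).filter fun y : ℕ => y % 2 = 1).image fun y : ℕ => ![(L : ℤ), (y : ℤ)]); let V : ℕ → Finset (Literature.Probability.LatticeModels.Site 2) := fun N => (Finset.range (L + 1) ×ˢ Finset.range N).image fun p : ℕ × ℕ => ![(p.1 : ℤ) - 1, (p.2 : ℤ)]; let ξ : Literature.Probability.LatticeModels.Site 2 → Bool := fun z => decide (z 0 = -1 ∨ (z 0 = (L : ℤ) ∧ z 1 % 2 = 0) ∨ z 0 = (L : ℤ) + 1); let μM : ℕ → MeasureTheory.Measure Literature.Probability.LatticeModels.CellConfig :=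 fun N => (Literature.Probability.LatticeModels.cornerGibbsMeasure (Literature.Probability.LatticeModels.ikCornerFugacity (Real.pi / 2)) (V N) (Λ N) ξ).prod (Literature.Probability.LatticeModels.coinMeasure (Literature.Probability.LatticeModels.ikCoinBias (Real.pi / 2))); let μT : ℕ → MeasureTheory.Measure Literature.Probability.LatticeModels.CellConfig := fun N => (Literature.Probability.LatticeModels.cornerGibbsMeasure 1 ∅ (Λ N) ξ).prod (MeasureTheory.Measure.dirac Literature.Probability.LatticeModels.herringboneCoin); ∀ m : Fin (L + 1 + 2) → Fin (L + 1 + 2) → Bool, ∃ p : ENNReal, Filter.Tendsto (fun N => μM N {ω | Literature.Probability.LatticeModels.baseState (L + 1) ω = m}) Filter.atTop (nhds p) ∧ Filter.Tendsto (fun N => μT N {ω | Literature.Probability.LatticeModels.baseState (L + 1) ω = m}) Filter.atTop (nhds p)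

/-- item stmt-CriticalPhenomena-7747 · crux · rank 3 · open · by planner
why it might fail: One-lattice universality for dependent colourings with no FKG/RSW at 0<t<√3/2 (Holley fails for the plaquette weight); t→0⁺ singular (corr. length ≈1/(2t), corner = XOR with a quadrant); with the comb wall making r2 exact the t=0 limit is boundary-dependent: closed [0,√3/2] suspect (TELEPORT-CHECK).
sources: Beffara2008Universal, arXiv:0708.3908, GarbanPeteSchramm2010, BloteNienhuis1989, lean:Literature.Barriers.CriticalPhenomena.CoveringLatticeShift, evidence:stmt-CriticalPhenomena-7739/TELEPORT-CHECK.md §F3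
[crux] CornerIrrelevanceWall (rank 3; the open content of the line; informal until definition
cornerFugacityStrip lands). For all 0 < a < b < 1: the probability, under the corner-fugacity strip
model M(t, 1/2) of width L with fixed-black walls (colouring of {0..L-1} x N weighted t^#(3-1
plaquettes), fair saddle coins), that some black base cell (x,0) with aL <= x <= bL is joined inside
the strip to a wall cell, converges as L -> oo to a limit Phi(a,b) that does NOT depend on t in [0,
sqrt3/2] (equivalently: the limits at t = 0 and t = sqrt3/2 exist and agree). With the definition:
forall a b, 0<a<b<1 -> exists Phi, forall t in Icc 0 (sqrt3/2), Tendsto (fun L =>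
P_{t,1/2,L}(wallEvent L [aL,bL])) atTop (nhds Phi). Together with IKWallLawTeleport (t = sqrt3/2 end
= site-T, Smirnov proved) and FreezeToWiredDiagonal (t = 0 end = bond-Z^2 on the 45-degree renewal
lattice) it yields TallDiagonalRectCardy. WHY IT MIGHT FAIL: it is one-lattice universality along a
line of distinct dependent percolation models with NO FKG (Holley fails for the plaquette weight
t^[sigma sigma sigma sigma = -1]) hence no RSW technology for 0 < t < sqrt3/2; t -> 0+ is a singular
limit (colouring marginal = 4-sp -/
@[route_item "route-CriticalPhenomena-CardyCornerFugacity"]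
def CornerIrrelevanceWall : Prop :=
  ∀ a b : ℝ, 0 < a → a < b → b < 1 → ∃ Φ : ℝ, ∀ t ∈ Set.Icc (0 : ℝ) (Real.sqrt 3 / 2), Filter.Tendsto (fun L : ℕ => (Literature.Probability.LatticeModels.cornerFugacityStrip t Literature.Probability.Percolation.half L (Literature.Probability.LatticeModels.wallEvent L {x : ℕ | a * L ≤ x ∧ (x : ℝ) ≤ b * L})).toReal) Filter.atTop (nhds Φ)

/-- item stmt-CriticalPhenomena-7312 · crux · rank 4 · open · by planner
why it might fail: Cardy values for bond-ℤ² are open in every domain family (B–R Ch.7 Conj.1); the line reaches them only via CornerIrrelevanceWall (no FKG/RSW at 0<t<√3/2) and a t=0 endpoint the comb wall of r2 breaks (TELEPORT-CHECK F3); as typed, h₀ uniform in marks up to the corners needs a cross-ratio lemma.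
sources: BollobasRiordan2006, Cardy1992, Smirnov2001, Beffara2008Universal, arXiv:2211.12379, lean:Literature.Probability.Percolation.rsw_half_holds
[crux] Cardy up to ε for tall diagonal rectangles with wall events: for every η ∈ (0,1) and ε > 0
there is h₀ such that for all h ≥ h₀ and every conformal rectangle R with carrier
(1+i)·((0,1)×(0,h)), marks R.pt 0, R.pt 1 in the open base segment (0, 1+i), R.pt 2 = 1+i, R.pt 3 =
0, and a uniformizing datum of cross-ratio η, eventually as δ → 0⁺ |bondDomainCrossingProb R δ −
F(η)| ≤ ε. This is what IKWallLawTeleport + CornerIrrelevanceWall + the freezing identification +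
Smirnov (proved) + e^(−ch) truncation (rsw_half_holds) deliver (card F2/F4, corrected to the
diagonal/wall geometry). [difficulty: open-problem] -/
@[route_item "route-CriticalPhenomena-CardyCornerFugacity", crux]
def TallDiagonalRectCardy : Prop :=
  ∀ η ∈ Set.Ioo (0:ℝ) 1, ∀ ε : ℝ, 0 < ε → ∃ h₀ : ℝ, ∀ h : ℝ, h₀ ≤ h → ∀ (R : Literature.Probability.RandomPlanarGeometry.ConformalRectangle), R.carrier = (fun z : ℂ ↦ (1 + Complex.I) * z) '' (Set.Ioo (0:ℝ) 1 ×ℂ Set.Ioo (0:ℝ) h) → R.pt 0 ∈ openSegment ℝ (0:ℂ) (1 + Complex.I) → R.pt 1 ∈ openSegment ℝ (0:ℂ) (1 + Complex.I) → R.pt 2 = 1 + Complex.I → R.pt 3 = 0 → ∀ (φ : Literature.Probability.RandomPlanarGeometry.ConformalEquiv UpperHalfPlane.upperHalfPlaneSet R.carrier) (x : Fin 4 → ℝ), R.IsUniformizing φ x → Literature.Probability.RandomPlanarGeometry.crossRatio x = η → ∀ᶠ δ in nhdsWithin (0:ℝ) (Set.Ioi 0), |Literature.Probability.Percolation.bondDomainCrossingProb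 R δ - Literature.Probability.RandomPlanarGeometry.cardyFunction η| ≤ ε

/-- item stmt-CriticalPhenomena-7313 · crux · rank 5 · open · by planner
why it might fail: Conformal covariance of subsequential crossing limits on bond-ℤ² = B–R Ch.7 Conj.1 minus existence: open; with R′=λR it asserts scale covariance along a mesh sequence (≈ X_U itself); only rotations are proved (DKKMO arXiv:2012.11672 Thm 1.2); EmbeddingModulusUniqueness bars embedding-blind proofs.
sources: BollobasRiordan2006, DKKMO2020Rotational, Schramm2007ICM, Smirnov2001, lean:Literature.Barriers.CriticalPhenomena.EmbeddingModulusUniqueness, lean:Literature.Probability.Percolation.dkkmo_theorem_1_2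
[crux] conformal transport of SUBSEQUENTIAL crossing limits on ℤ²: if R, R' have uniformizing data
of equal cross-ratio and s_k → 0⁺, then bondDomainCrossingProb R (s_k) → L implies
bondDomainCrossingProb R' (s_k) → L. Implied by LimitExists ∧ ConfInvTransport (stmt-0747 ∧
stmt-0794) and by X_U (stmt-0745); it is the crossing-event shadow of
ConformalCovarianceOfSubseqLimits (route CardyViaSLE6 r2) — imported from the DKKMO programme, not
attacked here. [difficulty: open-problem] -/
@[route_item "route-CriticalPhenomena-CardyCornerFugacity", crux]
def SeqConfTransport : Prop :=
  ∀ (R R' : Literature.Probability.RandomPlanarGeometry.ConformalRectangle) (φ : Literature.Probability.RandomPlanarGeometry.ConformalEquiv UpperHalfPlane.upperHalfPlaneSet R.carrier) (x : Fin 4 → ℝ) (φ' : Literature.Probability.RandomPlanarGeometry.ConformalEquiv UpperHalfPlane.upperHalfPlaneSet R'.carrier) (x' : Fin 4 → ℝ), R.IsUniformizing φ x → R'.IsUniformizing φ' x' → Literature.Probability.RandomPlanarGeometry.crossRatio x = Literature.Probability.RandomPlanarGeometry.crossRatio x' → ∀ (s : ℕ → ℝ), Filter.Tendsto s Filter.atTop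 (nhdsWithin 0 (Set.Ioi 0)) → ∀ L : ℝ, Filter.Tendsto (fun k ↦ Literature.Probability.Percolation.bondDomainCrossingProb R (s k)) Filter.atTop (nhds L) → Filter.Tendsto (fun k ↦ Literature.Probability.Percolation.bondDomainCrossingProb R' (s k)) Filter.atTop (nhds L)

/-- item stmt-CriticalPhenomena-13904 · crux · rank 6 · open · by planner
why it might fail: Boundary-condition irrelevance for a dependent, non-FKG colouring model with no RSW or coupling: a corner cost along the wall could pin or repel hulls and shift base-to-wall limits at t<1; exact numerics at L≤8 cannot exclude an O(L^-ε) drift, only t=1 is trivially safe.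
sources: Cardy1992, arXiv:2211.12379, BloteNienhuis1989, Beffara2008Universal, evidence:stmt-CriticalPhenomena-7739/CRUX-ATTACK-7739.md (route consequences §5), lean:Literature.Probability.LatticeModels.cornerFugacityStrip
[crux] IsotropicWallSeam (rank 6; NEW — the one seam the repair of r2 opens). At the isotropic point
(t, b) = (√3/2, ½) and for 0 < a < b < 1: if, for every L ≥ 1, q_L is the N → ∞ limit of the
probability — under the M side of IKWallLawTeleportR (MDKP strip S_L: alternating widths, EVERY full
face weighted incl. the wall faces, fair coins; same Λ, V, ξ term as r2) — that some black base cell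
x ∈ [aL, bL] is joined inside the closed strip to a wall (wallEvent L {x | aL ≤ x ≤ bL}), and if the
same wall-event probability under the PLAIN strip law cornerFugacityStrip (√3/2) ½ L of D1 (constant
width L, solid black walls x = −1, L, wall faces UNweighted — the product-of-bits model) tends to Φ
as L → ∞, then q_L → Φ. In words: the boundary modification {alternating width + corner cost √3/2 on
the wall faces} is irrelevant for base-to-wall events in the L → ∞ limit. WHY NEEDED: the teleport
r2 lands on the weighted MDKP wall, but the corner-fugacity descent t ↓ 0 (CornerIrrelevanceWall r3,
FreezeToWiredDiagonal) must run on the plain wall — with weighted wall faces t → 0 freezes the strip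
into vertical stripes (refuter CRUX-ATTACK-7739.md §5: XOR constraint through a monochromatic wall c -/
@[route_item "route-CriticalPhenomena-CardyCornerFugacity"]
def IsotropicWallSeam : Prop :=
  ∀ a b : ℝ, 0 < a → a < b → b < 1 → ∀ (q : ℕ → ℝ) (Φ : ℝ), (∀ L : ℕ, 1 ≤ L → let Λ : ℕ → Finset (Literature.Probability.LatticeModels.Site 2) := fun N => ((Finset.range L ×ˢ Finset.range (N + 1)).image fun p : ℕ × ℕ => ![(p.1 : ℤ), (p.2 : ℤ)]) ∪ (((Finset.range (N + 1)).filter fun y : ℕ => y % 2 = 1).image fun y : ℕ => ![(L : ℤ), (y : ℤ)]); let V : ℕ → Finset (Literature.Probability.LatticeModels.Site 2) := fun N => (Finset.range (L + 1) ×ˢ Finset.range N).image fun p : ℕ × ℕ => ![(p.1 : ℤ) - 1, (p.2 : ℤ)]; let ξ : Literature.Probability.LatticeModels.Site 2 → Bool := fun z => decide (z 0 = -1 ∨ (z 0 = (L : ℤ) ∧ z 1 % 2 = 0) ∨ z 0 = (L : ℤ) + 1); let μM : ℕ → MeasureTheory.Measure Literature.Probability.LatticeModels.CellConfig := fun N =>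 (Literature.Probability.LatticeModels.cornerGibbsMeasure (Literature.Probability.LatticeModels.ikCornerFugacity (Real.pi / 2)) (V N) (Λ N) ξ).prod (Literature.Probability.LatticeModels.coinMeasure (Literature.Probability.LatticeModels.ikCoinBias (Real.pi / 2))); Filter.Tendsto (fun N => (μM N (Literature.Probability.LatticeModels.wallEvent L {x : ℕ | a * L ≤ x ∧ (x : ℝ) ≤ b * L})).toReal) Filter.atTop (nhds (q L))) → Filter.Tendsto (fun L : ℕ => (Literature.Probability.LatticeModels.cornerFugacityStrip (Real.sqrt 3 / 2) Literature.Probability.Percolation.half L (Literature.Probability.LatticeModels.wallEvent L {x : ℕ | a * L ≤ x ∧ (x : ℝ) ≤ b * L})).toReal) Filter.atTop (nhds Φ) → Filter.Tendsto q Filter.atTop (nhds Φ)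

/-- item stmt-CriticalPhenomena-13903 · support · rank 9 · open · by planner
sources: Smirnov2001, Cardy1992, Werner2007, arXiv:2211.12379, lean:Literature.Probability.Percolation.hasCrossingLimit_triDomainCrossingProb_holds, lean:Literature.Probability.Percolation.rsw_half_holds
[support] TriStripWallCardy (rank 9; replaces HerringboneWallCardyT = stmt-CriticalPhenomena-7756,
whose constant-width herringbone strip is no longer the 𝕋 side of the teleport). Smirnov's theorem
(tree: hasCrossingLimit_triDomainCrossingProb_holds, PROVED) implies: for critical site percolation
on the MDKP triangular strip S_L (the T side of IKWallLawTeleportR: cornerGibbsMeasure 1 ∅ Λ ξ ⊗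
δ_herringboneCoin, rows of alternating width L / L+1 free cells, outermost cells fixed black,
truncated at height N → ∞ first, limits q_L), for 0 < a < b < 1 the probability that some black base
cell x ∈ [aL, bL] is joined to a wall satisfies q_L → F(η(a,b)) as L → ∞, with F = cardyFunction and
η(a,b) = crossRatio (−cos πa, −cos πb, 1, −1) ∈ (0,1): the half-strip (0,1) × (0,∞) marked at a, b
on the base and at its base corners c = 1, d = 0 is uniformised by w = −cos πz (d ↦ −1, a ↦ −cos πa,
b ↦ −cos πb, c ↦ 1; the tuple is cyclically ordered and the cross-ratio formula is Möbius invariant,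
e.g. η(1/3, 1/2) = 2/3), so F(η) is Cardy's crossing probability from the base arc [a,b] to the arc
{right wall} ∪ {∞} ∪ {left wall} = 'joined to a wall'. Proof sketch: the graph S_L is a width-L
strip of the -/
@[route_item "route-CriticalPhenomena-CardyCornerFugacity"]
def TriStripWallCardy : Prop :=
  ∀ a b : ℝ, 0 < a → a < b → b < 1 → ∀ q : ℕ → ℝ, (∀ L : ℕ, 1 ≤ L → let Λ : ℕ → Finset (Literature.Probability.LatticeModels.Site 2) := fun N => ((Finset.range L ×ˢ Finset.range (N + 1)).image fun p : ℕ × ℕ => ![(p.1 : ℤ), (p.2 : ℤ)]) ∪ (((Finset.range (N + 1)).filter fun y : ℕ => y % 2 = 1).image fun y : ℕ => ![(L : ℤ), (y : ℤ)]); let ξ : Literature.Probability.LatticeModels.Site 2 → Bool := fun z => decide (z 0 = -1 ∨ (z 0 = (L : ℤ) ∧ z 1 % 2 = 0) ∨ z 0 = (L : ℤ) + 1); let μT : ℕ → MeasureTheory.Measure Literature.Probability.LatticeModels.CellConfig := fun N => (Literature.Probability.LatticeModels.cornerGibbsMeasure 1 ∅ (Λ N) ξ).prod (MeasureTheory.Measure.dirac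 Literature.Probability.LatticeModels.herringboneCoin); Filter.Tendsto (fun N => (μT N (Literature.Probability.LatticeModels.wallEvent L {x : ℕ | a * L ≤ x ∧ (x : ℝ) ≤ b * L})).toReal) Filter.atTop (nhds (q L))) → Filter.Tendsto q Filter.atTop (nhds (Literature.Probability.RandomPlanarGeometry.cardyFunction (Literature.Probability.RandomPlanarGeometry.crossRatio ![-Real.cos (Real.pi * a), -Real.cos (Real.pi * b), 1, -1])))

/-- item stmt-CriticalPhenomena-7314 · support · rank 9 · open · by planner
sources: Ahlfors1979, lean:Literature.Probability.RandomPlanarGeometry.MarkedDomain.exists_isUniformizing_holds, lean:Literature.Probability.RandomPlanarGeometry.CaratheodoryExtension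
[support] for every h > 0 and η ∈ (0,1) there is a conformal rectangle with carrier
(1+i)·((0,1)×(0,h)), marks a, b in the open base, c = 1+i, d = 0, and a uniformizing datum of
cross-ratio η (Jordan parametrisation of the rectangle boundary; exists_isUniformizing_holds;
continuity + intermediate value as b runs from a to the corner: η sweeps (0,1)). Pure complex
analysis, the analogue of EquilateralRealises (stmt-0795). [difficulty: provable-now] -/
@[route_item "route-CriticalPhenomena-CardyCornerFugacity", crux]
def BaseMarkedRealises : Prop :=
  ∀ h : ℝ, 0 < h → ∀ η ∈ Set.Ioo (0:ℝ) 1, ∃ (R : Literature.Probability.RandomPlanarGeometry.ConformalRectangle) (φ : Literature.Probability.RandomPlanarGeometry.ConformalEquiv UpperHalfPlane.upperHalfPlaneSet R.carrier) (x : Fin 4 → ℝ), R.carrier = (fun z : ℂ ↦ (1 + Complex.I) * z) '' (Set.Ioo (0:ℝ) 1 ×ℂ Set.Ioo (0:ℝ) h) ∧ R.pt 0 ∈ openSegment ℝ (0:ℂ) (1 + Complex.I) ∧ R.pt 1 ∈ openSegment ℝ (0:ℂ) (1 + Complex.I) ∧ R.pt 2 = 1 + Complex.I ∧ R.pt 3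 = 0 ∧ R.IsUniformizing φ x ∧ Literature.Probability.RandomPlanarGeometry.crossRatio x = η

-- item stmt-CriticalPhenomena-7741 · support · rank 9 · open · by planner — informal only, no Lean statement yet:
--   [support] FreezeToWiredDiagonal (rank 9; identification + harmlessness at the frozen end; informal
--   until definition cornerFugacityStrip lands). (i) EXACT: at t = 0 the corner-fugacity strip model
--   with fixed-black walls is bond percolation at p = 1/2 on the 45-degree-ROTATED renewal sub-lattice:
--   colourings are sigma(x,y) = A_y xor a_0 xor ... xor a_{x-1} (A, a i.i.d. fair), walls of colour
--   change are the full row-lines {y : A_y != A_{y+1}} and column-lines {x : a_x = 1}, black rectangles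
--   form a copy of Z^2 rotated by 45 degrees (adjacent through checkerboard vertices, joined iff the
--   fair coin s

/-- item stmt-CriticalPhenomena-7315 · assembly · rank 1 · open · by planner
sources: Smirnov2001, Werner2007
[assembly] TallDiagonalRectCardy → SeqConfTransport → BaseMarkedRealises → CardyFormulaZ2. -/
@[route_item "route-CriticalPhenomena-CardyCornerFugacity"]
def Assembly : Prop :=
  TallDiagonalRectCardy → SeqConfTransport → BaseMarkedRealises → CardyFormulaZ2

-- records of items no longer active in this route (dropped / restated):
-- earlier IKWallLawTeleport (stmt-CriticalPhenomena-7739, replaced 2026-08-15T21:34:52Z -> stmt-CriticalPhenomena-13902): retired by None — [crux] IKWallLawTeleport (rank 2; the unproved integrability fact the line imports; informal until definition cornerFugacityStrip lands). For every width L, the LAW OF THE BASE STATE of the semi-infinite cell strip {0..L-1} x N with fixed-black reflecting walls 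
-- earlier HerringboneWallCardyT (stmt-CriticalPhenomena-7756, replaced 2026-08-15T21:34:52Z -> stmt-CriticalPhenomena-13903): retired by None — ∀ a b : ℝ, 0 < a → a < b → b < 1 → Filter.Tendsto (fun L : ℕ => (Literature.Probability.LatticeModels.herringboneTriStrip L (Literature.Probability.LatticeModels.wallEvent L {x : ℕ | a * L ≤ x ∧ (x : ℝ) ≤ b * L})).toReal) Filter.atTop (nhds (Literature.Proba

/-! D-0027 §2.1 — DECIDING THEOREM (planner-authored via `route open/edit --closes-file`; by planner-rbadge-CriticalPhenomena-CardyCornerFu-f08f1be1-g4-0 2026-08-15T16:12:24Z):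
its hypotheses are this route's items and its conclusion the sub-problem Statement (glue_lint), and it elaborates with this file. -/

@[closes "route-CriticalPhenomena-CardyCornerFugacity"] theorem closes (hT : TallDiagonalRectCardy) (hS : SeqConfTransport) (hB : BaseMarkedRealises) :
    _root_.CardyFormulaZ2 := by
  -- D-0027 §2.1 deciding theorem of route CardyCornerFugacity: hypotheses are the three TYPED items
  -- (TallDiagonalRectCardy r4, SeqConfTransport r5, BaseMarkedRealises support), conclusion the
  -- sub-problem Statement; the informal items (IKWallLawTeleport, CornerIrrelevanceWall,
  -- FreezeToWiredDiagonal, HerringboneWallCardyT) have no decl yet and feed TallDiagonalRectCardy.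
  -- Proof = the route's § Assembly (subsequence extraction): given a uniformizing datum (φ', x') of
  -- R', η = crossRatio x' ∈ (0,1); if P(R', δ) did not tend to F η, pick δ_k → 0⁺ keeping
  -- dist ≥ ε (exists_seq_forall_of_frequently); take a tall base-marked diagonal rectangle R of
  -- cross-ratio η with |P(R, δ) − F η| ≤ ε/3 eventually (BaseMarkedRealises + TallDiagonalRectCardy);
  -- Bolzano–Weierstrass in [0,1] gives P(R, δ_{ψ k}) → L; SeqConfTransport carries L to R';
  -- then ε ≤ |L − F η| ≤ ε/3, absurd.
  intro R' φ' x' hU'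
  have hη : Literature.Probability.RandomPlanarGeometry.crossRatio x' ∈ Set.Ioo (0:ℝ) 1 :=
    Literature.Probability.RandomPlanarGeometry.ConformalRectangle.crossRatio_mem_Ioo_of_isUniformizing hU'
  rw [Metric.tendsto_nhds]
  intro ε hε
  by_contra hnot
  obtain ⟨s, hs, hsP⟩ := Filter.exists_seq_forall_of_frequently (Filter.not_eventually.mp hnot)
  obtain ⟨h₀, hh₀⟩ := hT _ hη (ε / 3) (by positivity)
  obtain ⟨R, φ, x, hcar, hp0, hp1, hp2, hp3, hU, hx⟩ :=
    hB (max h₀ 1) (lt_of_lt_of_le one_pos (le_max_right _ _)) _ hη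
  have hev : ∀ᶠ δ in 𝓝[>] (0:ℝ),
      |Literature.Probability.Percolation.bondDomainCrossingProb R δ -
        Literature.Probability.RandomPlanarGeometry.cardyFunction
          (Literature.Probability.RandomPlanarGeometry.crossRatio x')| ≤ ε / 3 :=
    hh₀ (max h₀ 1) (le_max_left _ _) R hcar hp0 hp1 hp2 hp3 φ x hU hx
  have hev_s : ∀ᶠ n in atTop,
      |Literature.Probability.Percolation.bondDomainCrossingProb R (s n) -
        Literature.Probability.RandomPlanarGeometry.cardyFunction
          (Literature.Probability.RandomPlanarGeometry.crossRatio x')| ≤ ε / 3 :=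
    hs.eventually hev
  obtain ⟨L, -, ψ, hψ, hL⟩ := tendsto_subseq_of_bounded (Metric.isBounded_Icc (0:ℝ) 1)
    (x := fun n => Literature.Probability.Percolation.bondDomainCrossingProb R (s n))
    (fun n => Literature.Probability.Percolation.bondDomainCrossingProb_mem_Icc R (s n))
  have hL1 : Tendsto (fun k => Literature.Probability.Percolation.bondDomainCrossingProb R ((s ∘ ψ) k))
      atTop (𝓝 L) := hL
  have hL' : Tendsto (fun k => Literature.Probability.Percolation.bondDomainCrossingProb R' ((s ∘ ψ) k))
      atTop (𝓝 L) :=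
    hS R R' φ x φ' x' hU hU' hx (s ∘ ψ) (hs.comp hψ.tendsto_atTop) L hL1
  have hlow : ε ≤ |L - Literature.Probability.RandomPlanarGeometry.cardyFunction
      (Literature.Probability.RandomPlanarGeometry.crossRatio x')| := by
    refine ge_of_tendsto' ((hL'.sub_const _).abs) fun k => ?_
    have := hsP (ψ k)
    rw [Real.dist_eq, not_lt] at this
    exact this
  have hup : |L - Literature.Probability.RandomPlanarGeometry.cardyFunction
      (Literature.Probability.RandomPlanarGeometry.crossRatio x')| ≤ ε / 3 :=
    le_of_tendsto ((hL1.sub_const _).abs) (hψ.tendsto_atTop.eventually hev_s)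
  linarith

end Summit.CriticalPhenomena.CardyFormulaZ2.Theses.CardyCornerFugacity
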